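import Summits.HodgeConjecture.CorCM.GaloisCyclicByMultipliersDegenerate
import HarnessLib

/-!
# Skew CM sets survive DIRECT PRODUCTS with any finite group: `K₁` skew-bad and `L` totally real Galois, disjoint
# from `K₁` ⟹ `K₁ L` has a simple degenerate CM abelian variety

COR-CM (cell `pub-hodgecm2`), binder seat b04 (gen 23), count-neutral claim CYCLIC-BY-MULTIPLIERS, part V (sequel of
part I `CorCM/GaloisRightStabiliserDegenerate`).  KERNEL ONLY: theorems; no definition, no named fact, no `sorry`.
`HC_CM` is neither used nor claimed.

SETTING.  `K/ℚ` Galois CM with `e : Gal(K/ℚ) ≃* G₁ × G₂` and complex conjugation `e(c) = (c₁, 1)` — i.e. `K = K₁ L`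
with `K₁ = K^{1 × G₂}` a Galois CM field with group `G₁` and `L = K^{G₁ × 1}` a totally real Galois field with group
`G₂`, `K₁ ∩ L = ℚ`.  A SKEW CM set on `G₁` (part I: `T₁ ⊆ G₁` with `x ∈ T₁ ↔ c₁ x ∉ T₁`, trivial left stabiliser,
`T₁ u = T₁` for some `u ≠ 1`) is TWISTED along `G₂`:

  `T = {(x, y) : t_y⁻¹ x ∈ T₁}`, `t_1 = 1`, `t_y = t` (`y ≠ 1`) for any `t ∈ G₁` with `t² ≠ 1`

(such `t` exists: a group all of whose elements square to `1` is abelian, and an abelian group has no skew set since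
its left and right stabilisers agree — §1 `exists_sq_ne_one_of_skew`).  Then (§1) `T` is a CM set for `(c₁, 1)`,
right-invariant under `(u, 1)`, and of trivial LEFT stabiliser: `(a, 1)` needs `a T₁ = T₁`; `(a, z)` with `z ≠ 1`
needs `t⁻¹ a T₁ = T₁` (fibre `1 ↦ z`) and `a t T₁ = T₁` (fibre `z⁻¹ ↦ 1`), so `a = t` and `t² = 1` — excluded.
Hence (§2) **`exists_simple_degenerate_of_model_skew_prod`**: a SIMPLE DEGENERATE abelian variety of dimension
`|G₁||G₂|/2` with CM by `K`, with an exceptional Hodge class on some power.  In words: **badness certified by a skew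
set is stable under composita with linearly disjoint totally real Galois fields** (plain badness need not be: a
primitive degenerate type of `K₁` lifts to an IMPRIMITIVE type of `K₁ L`).  §3 instantiates this with part III:
`Gal(K/ℚ) ≅ (C_{2h} ⋊ U) × G₂` (`U ≠ 1` faithful multipliers avoiding `−1`, `c = (α^h, 1)`) is BAD — e.g.
`SD₁₆ × C₂` with `c = (α⁴, 1)` (order 32), `M₁₆ × S₃`, `(C₁₆ ⋊ C₄) × A` for any finite `A`.

## References

* [Shimura1998] G. Shimura, *Abelian Varieties with Complex Multiplication and Modular Functions*, §6.2 Thm. 3,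
  §8.2 Prop. 26, §18.2 Lemma (i), §32.10.
* [Gordon1999HodgeAVSurvey] B. B. Gordon, *A survey of the Hodge conjecture for abelian varieties*, Thm. 6.4, §9.3.
-/

noncomputable section

open CategoryTheory CategoryTheory.Limits NumberField
open scoped BigOperators

namespace Summit.HodgeConjecture.CorCM.GaloisModels

open Literature.NumberTheory.ComplexMultiplication
open Literature.AlgebraicGeometry.Motives (AbelianVariety CMType)
open Literature.AlgebraicGeometry.HodgeTheory
open Literature.AlgebraicGeometry.ComplexMultiplication (IsCMTypeRealisation)
open Literature.AlgebraicGeometry.Pohlmann1968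
open Literature.Barriers.HodgeConjecture (divisorClassesSpan)
open Summit.HodgeConjecture.CorCM.GaloisCosetInterval

/-! ## §1 The twisted product of a skew set -/

section Group

variable {G₁ G₂ : Type*} [Group G₁] [Group G₂] {T₁ : Finset G₁} {c₁ u t : G₁}

/-- **A group with a skew CM set has an element `t` with `t² ≠ 1`**: otherwise every element is an involution, the
group is abelian, and the right-stabilising `u ≠ 1` would also stabilise on the left. [folklore] -/
theorem exists_sq_ne_one_of_skew (hprim : ∀ v : G₁, v ≠ 1 → ∃ w : G₁, ¬ (w ∈ T₁ ↔ v * w ∈ T₁))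
    (hu : u ≠ 1) (hTu : ∀ x : G₁, x * u ∈ T₁ ↔ x ∈ T₁) : ∃ t : G₁, t * t ≠ 1 := by
  by_contra hall
  push Not at hall
  -- all squares trivial ⟹ commutative
  have hcomm : ∀ a b : G₁, a * b = b * a := fun a b => by
    have hab := hall (a * b)
    have ha := hall a
    have hb := hall b
    have ha' : a⁻¹ = a := inv_eq_of_mul_eq_one_right ha
    have hb' : b⁻¹ = b := inv_eq_of_mul_eq_one_right hb
    have : (a * b)⁻¹ = a * b := inv_eq_of_mul_eq_one_right hab
    rw [mul_inv_rev, ha', hb'] at this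
    exact this.symm
  obtain ⟨w, hw⟩ := hprim u hu
  exact hw (by rw [hcomm u w]; exact (hTu w).symm)

/-- **The twisted product set exists**: `(x, y) ∈ T ↔ x ∈ T₁` for `y = 1` and `↔ t⁻¹ x ∈ T₁` for `y ≠ 1`. [folklore] -/
theorem exists_skewProd [Fintype G₁] [Fintype G₂] [DecidableEq G₁] [DecidableEq G₂] (T₁ : Finset G₁) (t : G₁) :
    ∃ T : Finset (G₁ × G₂), (∀ x : G₁, (x, (1 : G₂)) ∈ T ↔ x ∈ T₁) ∧
      (∀ x : G₁, ∀ y : G₂, y ≠ 1 → ((x, y) ∈ T ↔ t⁻¹ * x ∈ T₁)) := by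
  refine ⟨Finset.univ.filter fun p => (p.2 = 1 ∧ p.1 ∈ T₁) ∨ (p.2 ≠ 1 ∧ t⁻¹ * p.1 ∈ T₁), fun x => ?_,
    fun x y hy => ?_⟩
  · simp
  · simp [hy]

variable {T : Finset (G₁ × G₂)}

/-- **CM set for `(c₁, 1)`** (`c₁` central in `G₁`). [cite: Shimura1998, §18.2 Lemma (i)] -/
theorem skewProd_cm (hcomm : ∀ x : G₁, c₁ * x = x * c₁) (hcm : ∀ x : G₁, x ∈ T₁ ↔ c₁ * x ∉ T₁)
    (hT1 : ∀ x : G₁, (x, (1 : G₂)) ∈ T ↔ x ∈ T₁)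
    (hTt : ∀ x : G₁, ∀ y : G₂, y ≠ 1 → ((x, y) ∈ T ↔ t⁻¹ * x ∈ T₁)) (p : G₁ × G₂) :
    p ∈ T ↔ ((c₁, (1 : G₂)) : G₁ × G₂) * p ∉ T := by
  obtain ⟨x, y⟩ := p
  rw [Prod.mk_mul_mk, one_mul]
  by_cases hy : y = 1
  · subst hy
    rw [hT1, hT1]
    exact hcm x
  · rw [hTt x y hy, hTt _ y hy, ← mul_assoc, ← hcomm t⁻¹, mul_assoc]
    exact hcm _

/-- **Right invariance under `(u, 1)`.** [folklore] -/
theorem skewProd_mul_right (hTu : ∀ x : G₁, x * u ∈ T₁ ↔ x ∈ T₁)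
    (hT1 : ∀ x : G₁, (x, (1 : G₂)) ∈ T ↔ x ∈ T₁)
    (hTt : ∀ x : G₁, ∀ y : G₂, y ≠ 1 → ((x, y) ∈ T ↔ t⁻¹ * x ∈ T₁)) (p : G₁ × G₂) :
    p * ((u, (1 : G₂)) : G₁ × G₂) ∈ T ↔ p ∈ T := by
  obtain ⟨x, y⟩ := p
  rw [Prod.mk_mul_mk, mul_one]
  by_cases hy : y = 1
  · subst hy
    rw [hT1, hT1, hTu]
  · rw [hTt x y hy, hTt _ y hy, ← mul_assoc, hTu]

/-- **TRIVIAL LEFT STABILISER of the twisted product** (`t² ≠ 1`): `(a, 1)` needs `a T₁ = T₁`; `(a, z)` with `z ≠ 1`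
needs `t⁻¹ a ∈ Stab(T₁)` (fibre `1 ↦ z`) and `a t ∈ Stab(T₁)` (fibre `z⁻¹ ↦ 1`), so `a = t = t⁻¹`.
[cite: Shimura1998, §8.2 Prop. 26] -/
theorem skewProd_leftStabiliser (hprim : ∀ v : G₁, v ≠ 1 → ∃ w : G₁, ¬ (w ∈ T₁ ↔ v * w ∈ T₁))
    (ht : t * t ≠ 1) (hT1 : ∀ x : G₁, (x, (1 : G₂)) ∈ T ↔ x ∈ T₁)
    (hTt : ∀ x : G₁, ∀ y : G₂, y ≠ 1 → ((x, y) ∈ T ↔ t⁻¹ * x ∈ T₁)) (v : G₁ × G₂) (hv : v ≠ 1) :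
    ∃ w : G₁ × G₂, ¬ (w ∈ T ↔ v * w ∈ T) := by
  obtain ⟨a, z⟩ := v
  by_cases hz : z = 1
  · subst hz
    have ha : a ≠ 1 := fun h1 => hv (by rw [h1]; rfl)
    obtain ⟨w, hw⟩ := hprim a ha
    refine ⟨(w, 1), fun hiff => hw ?_⟩
    rwa [Prod.mk_mul_mk, one_mul, hT1, hT1] at hiff
  · by_contra hall
    push Not at hall
    -- fibre `1 ↦ z`: `t⁻¹ a` stabilises `T₁`, so `a = t`
    have h1 : t⁻¹ * a = 1 := by
      by_contra hne
      obtain ⟨w, hw⟩ := hprim _ hne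
      apply hw
      have := hall (w, 1)
      rwa [Prod.mk_mul_mk, mul_one, hT1, hTt _ z hz, ← mul_assoc] at this
    have ha : a = t := by
      rw [← mul_left_cancel_iff (a := t⁻¹), h1, inv_mul_cancel]
    -- fibre `z⁻¹ ↦ 1`: `a t` stabilises `T₁`, so `t² = 1`
    have hz' : z⁻¹ ≠ 1 := fun h => hz (inv_eq_one.1 h)
    have h2 : a * t = 1 := by
      by_contra hne
      obtain ⟨w, hw⟩ := hprim _ hne
      apply hw
      have := hall (t * w, z⁻¹)
      rwa [Prod.mk_mul_mk, mul_inv_cancel, hTt _ z⁻¹ hz', inv_mul_cancel_left, hT1, ← mul_assoc] at this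
    rw [ha] at h2
    exact ht h2

end Group

/-! ## §2 Field level: skew badness survives composita with totally real Galois fields -/

section Field

variable {K : Type} [Field K] [NumberField K] [IsCMField K] [IsGalois ℚ K]
variable {G₁ G₂ : Type*} [Group G₁] [Group G₂] [Fintype G₁] [Fintype G₂] [DecidableEq G₁] [DecidableEq G₂]

/-- **THEOREM (skew sets survive direct products).**  `K` Galois CM, `e : Gal(K/ℚ) ≃* G₁ × G₂` with `e(c) = (c₁, 1)`
(`K = K₁ L`, `K₁` Galois CM with group `G₁`, `L` totally real Galois with group `G₂`, disjoint), and a SKEW CM set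
`T₁ ⊆ G₁` for `c₁` (trivial left stabiliser, `T₁ u = T₁` for some `u ≠ 1`).  Then `K` has a SIMPLE DEGENERATE abelian
variety of dimension `|G₁|·|G₂|/2` with CM by `K`, with an exceptional Hodge class on some power.
[cite: Shimura1998, §6.2 Thm. 3, §8.2 Prop. 26 and §32.10] [cite: Gordon1999HodgeAVSurvey, Thm. 6.4] -/
theorem exists_simple_degenerate_of_model_skew_prod (e : (K ≃ₐ[ℚ] K) ≃* G₁ × G₂) (c₁ : G₁)
    (hc : e ((IsCMField.complexConj K).restrictScalars ℚ) = (c₁, 1)) (T₁ : Finset G₁)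
    (hcm : ∀ x : G₁, x ∈ T₁ ↔ c₁ * x ∉ T₁) (hprim : ∀ v : G₁, v ≠ 1 → ∃ w : G₁, ¬ (w ∈ T₁ ↔ v * w ∈ T₁))
    {u : G₁} (hu : u ≠ 1) (hTu : ∀ x : G₁, x * u ∈ T₁ ↔ x ∈ T₁) :
    ∃ (Φ : CMType K) (φ₀ : K →+* ℂ) (A : AbelianVariety ℂ) (ι : 𝓞 K →+* End A)
      (θ : K →+* Module.End ℂ (complexBetti A.X 1)),
      IsPrimitive (ℂ ≃+* ℂ) Φ.1 φ₀ ∧ ¬ IsNondegenerate Φ ∧ IsCMTypeRealisation Φ A ι θ ∧ A.IsSimple ∧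
      A.dim = Fintype.card G₁ * Fintype.card G₂ / 2 ∧
      ∃ n p : ℕ, ∃ x : complexBetti (⨁ fun _ : Fin n => A).X (2 * p), IsRationalClass x ∧
        IsOfHodgeType (⨁ fun _ : Fin n => A).dim (⨁ fun _ : Fin n => A).X (2 * p) p p x ∧
        x ∉ divisorClassesSpan (⨁ fun _ : Fin n => A).X (⨁ fun _ : Fin n => A).dim p := by
  obtain ⟨t, ht⟩ := exists_sq_ne_one_of_skew hprim hu hTu
  obtain ⟨T, hT1, hTt⟩ := exists_skewProd (G₂ := G₂) T₁ t
  -- `c₁` is central in `G₁` because `(c₁, 1)` is central in `G₁ × G₂`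
  have hcomm : ∀ x : G₁, c₁ * x = x * c₁ := fun x => by
    have := GaloisRank.model_complexConj_comm e hc (x, 1)
    rw [Prod.mk_mul_mk, Prod.mk_mul_mk, one_mul] at this
    exact (Prod.mk.inj this).1
  have hu' : ((u, (1 : G₂)) : G₁ × G₂) ≠ 1 := fun h => hu (Prod.mk.inj h).1
  have hmain := exists_simple_degenerate_of_model_skew e (c₁, 1) hc T (skewProd_cm hcomm hcm hT1 hTt)
    (skewProd_leftStabiliser hprim ht hT1 hTt) hu' (skewProd_mul_right hTu hT1 hTt)
  rwa [Fintype.card_prod] at hmain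

/-! ## §3 Example: `(C_{2h} ⋊ U) × G₂` -/

/-- **`Gal(K/ℚ) ≅ G₁ × G₂` with `G₁ = ⟨α⟩ ⋊ U` cyclic-by-multipliers (`U ≠ 1` faithful, no inversion, `h ≥ 2`) and
`c = (α^h, 1)`: a SIMPLE DEGENERATE abelian variety of dimension `h|U||G₂|`** (part III's coset interval, twisted
along `G₂`; e.g. `SD₁₆ × C₂`, `M₁₆ × C₂` with `c = (α⁴, 1)`, `(C₁₆ ⋊ C₄) × A`). [cite: Shimura1998, §6.2 Thm. 3,
§8.2 Prop. 26 and §32.10] [cite: Gordon1999HodgeAVSurvey, Thm. 6.4] -/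
theorem exists_simple_degenerate_of_cyclicByMultipliers_prod {h : ℕ} (h2 : 2 ≤ h)
    (e : (K ≃ₐ[ℚ] K) ≃* G₁ × G₂) (α : G₁) (U : Subgroup G₁) (hord : orderOf α = 2 * h)
    (hAU : ∀ w ∈ U, w ∈ Subgroup.zpowers α → w = 1) (hmult : ∀ w ∈ U, ∃ u : ℕ, w * α = α ^ u * w)
    (hfaith : ∀ w ∈ U, w * α = α * w → w = 1) (hninv : ∀ w ∈ U, w * α * w⁻¹ ≠ α⁻¹) (hU : U ≠ ⊥)
    (hcard : Fintype.card G₁ = 2 * h * Nat.card U)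
    (hc : e ((IsCMField.complexConj K).restrictScalars ℚ) = (α ^ h, 1)) :
    ∃ (Φ : CMType K) (φ₀ : K →+* ℂ) (A : AbelianVariety ℂ) (ι : 𝓞 K →+* End A)
      (θ : K →+* Module.End ℂ (complexBetti A.X 1)),
      IsPrimitive (ℂ ≃+* ℂ) Φ.1 φ₀ ∧ ¬ IsNondegenerate Φ ∧ IsCMTypeRealisation Φ A ι θ ∧ A.IsSimple ∧
      A.dim = h * Nat.card U * Fintype.card G₂ ∧
      ∃ n p : ℕ, ∃ x : complexBetti (⨁ fun _ : Fin n => A).X (2 * p), IsRationalClass x ∧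
        IsOfHodgeType (⨁ fun _ : Fin n => A).dim (⨁ fun _ : Fin n => A).X (2 * p) p p x ∧
        x ∉ divisorClassesSpan (⨁ fun _ : Fin n => A).X (⨁ fun _ : Fin n => A).dim p := by
  classical
  haveI : NeZero h := ⟨by omega⟩
  obtain ⟨T₁, hT₁⟩ := exists_cosetInterval (G := G₁) hord hAU
  obtain ⟨⟨u, huU⟩, hu1⟩ := Subgroup.ne_bot_iff_exists_ne_one.1 hU
  have hu1' : (u : G₁) ≠ 1 := fun h1 => hu1 (Subtype.ext h1)
  have hmain := exists_simple_degenerate_of_model_skew_prod e (α ^ h) hc T₁ (cosetInterval_cm hord hAU hcard hT₁)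
    (cosetInterval_leftStabiliser h2 hord hAU hcard hmult hfaith hninv hT₁) hu1'
    (cosetInterval_mul_right hord hAU hcard hT₁ huU)
  rwa [hcard, show 2 * h * Nat.card U * Fintype.card G₂ / 2 = h * Nat.card U * Fintype.card G₂ by
    rw [mul_assoc, mul_assoc, Nat.mul_div_cancel_left _ (by norm_num), mul_assoc]] at hmain

end Field

end Summit.HodgeConjecture.CorCM.GaloisModels

end
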